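import Literature.Barriers.CriticalPhenomena.FiniteRangeDecompositionSelfSimilarity
import Literature.Barriers.CriticalPhenomena.RigorousRGSmallParameterScalingFunctionPositivity
import Literature.Barriers.CriticalPhenomena.RigorousRGSmallParameterRiemannSum
import Literature.Barriers.CriticalPhenomena.WeaklySAWPerturbativeBeta
import HarnessLib

/-!
# The scaling function `G_L(·,0)` of the massless decomposition of `(-Δ_{ℤ^d})⁻¹` — compact support,
# the pairings `J_l = ∫G_L(y,0)G_L(y/L^l,0)dy`, and the asymptotics of the lattice pair sums
# `Σ_xΓ_k(x;0)Γ_{k+l}(x;0) = (L^k)²(L^{k+l})²(L^k)^d/((L^k)^d(L^{k+l})^d)·(J_l + O(1/L^k))`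

Sequel of `FiniteRangeDecompositionSelfSimilarity.lean` (`Γ_{k;0,x}(s) = (Λ²/Λ^d)(G_L(x/Λ, sΛ²) +
O(Λ⁻¹))`, `Λ = L^k`, `k ≥ 2`, `s ∈ [0,1]`, for the terms `Γ_k = LongRangePhi4.FRD.Gam` of the explicit
finite-range decomposition of `(-Δ_{ℤ^d}+s)⁻¹` of R. Bauerschmidt, PTRF 157 (2013) [Baue13a] — the
decomposition of Bauerschmidt–Brydges–Slade, CMP 337 (2015) [BBS2015], §5.1), mirroring for `Γ_k`
itself, at the critical value `s = 0`, the §10.4 layer that the tree carries for Slade's fractional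
covariances (`RigorousRGSmallParameterScalingFunctionRegularity.lean`:
`FRD.cZero_eq_zero_of_half_lt`; `RigorousRGSmallParameterCovariancePairAsymptotics.lean`:
`FRD.innerC0`, `FRD.sum_fracCov_mul_fracCov_asymp`, `FRD.innerC0_nonneg` — G. Slade, CMP 358 (2018),
§10.4, proof of Lemma 5.2.2: "let `R_{k,x} = C_{k;0,x} - c_k(x)`. Then `(C_k,C_{k+l}) = (c_k,c_{k+l}) +
(c_k,R_{k+l}) + (c_{k+l},R_k) + (R_k,R_{k+l})`. Riemann sum approximation gives … For the remaining
terms, we use the fact that the supports of `C_k` and `R_k` are `O(L^{dk})` … it follows from the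
Parseval equality, together with the nonnegativity of the Fourier transform `ĉ₀`, that each inner
product … is nonnegative, with the first term strictly positive"). These are the inputs of the limit
`lim_jβ_j(m² = 0)` of the perturbative coefficients `β_j = 8Σ_x(w_{j+1,x}² - w_{j,x}²)` of [BBS2015],
§6.1 (Assumption (A1)), which are quadratic in the `Γ_k`.

## What this file proves (everything; one definition `FRD.innerG0`, no named fact)

* **`cZeroKer_zero_eq_zero_of_half_lt`** (and `…_of_half_le`, `…_of_norm_gt`) — **`G_L(·,0)` is
  supported in `{|y|₁ ≤ ½}`**, derived from the finite range `Γ_{k;0,x} = 0` for `|x|₁ ≥ ½L^k` through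
  the self-similarity at `s = 0` and the Lipschitz continuity of `G_L` (`FRD.abs_cZeroKer_sub_le`);
* `innerG0 d L l` (**`J_l = ∫_{ℝ^d}G_L(y,0)G_L(y/L^l,0)dy`**), `pairKer_lipschitz_support`,
  `abs_innerG0_le`;
* **`sum_Gam_mul_Gam_asymp`** — for `d ≥ 1`, `L ≥ 2` there is `C` with, for all `k ≥ 2`, `l ≥ 0`,
  `|Σ_{|x|₁<½L^k}Γ_k(x;0)Γ_{k+l}(x;0) - P_{k,l}J_l| ≤ CP_{k,l}(L^k)⁻¹`,
  `P_{k,l} = ((L^k)²/(L^k)^d)((L^{k+l})²/(L^{k+l})^d)(L^k)^d` (at `d = 4`: `P_{k,l} = L^{-2l}`,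
  independent of `k` — the marginality of `d = 4`);
* `sum_Gam_mul_Gam_nonneg` (`(Γ_k(s),Γ_m(s)) ≥ 0` for `s ≥ 0`, Parseval and the limit `s ↓ 0`),
  **`innerG0_nonneg`** (`J_l ≥ 0`) and **`innerG0_zero_pos`** (`J_0 = ∫G_L(·,0)² > 0`,
  "with the first term strictly positive").
-/

noncomputable section

namespace Literature.Barriers.CriticalPhenomena

open _root_.MeasureTheory Set Filter
open scoped _root_.Topology Real

namespace LongRangePhi4

namespace FRD

open Literature.Probability.LatticeModels

variable {d : ℕ}

/-! ### Compact support of `G_L(·,0)` from the finite range of `Γ_k` -/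

/-- **`G_L(·,0)` is supported in `{|y|₁ ≤ ½}`**: for `d ≥ 1`, `L ≥ 2`, `Σ_i|y_i| > ½` implies
`G_L(y,0) = 0`. At lattice points `x/L^k` outside the range of `Γ_k`, the self-similarity at `s = 0`
gives `|G_L(x/L^k,0)| ≤ CL^{-k}`; these points are `L^{-k}`-dense and `G_L(·,0)` is Lipschitz.
[cite: Slade2017, §10.3 ("a smooth function c₀ : ℝ^d × [0,∞) → ℝ, with compact support in ℝ^d")] [cite: BauerschmidtBrydgesSlade2015LogCorr, §5.1 (finite range C_{j;x,y} = 0 if |x-y| ≥ ½L^j)] -/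
theorem cZeroKer_zero_eq_zero_of_half_lt (hd : 1 ≤ d) {L : ℝ} (hL : 2 ≤ L) {y : Fin d → ℝ}
    (hy : 1 / 2 < ∑ i, |y i|) : cZeroKer d L y 0 = 0 := by
  have hL1 : (1 : ℝ) ≤ L := by linarith
  have hL0 : (0 : ℝ) < L := by linarith
  obtain ⟨C, hC, h31⟩ := abs_Gam_sub_scaling_le hd hL
  obtain ⟨Lc, hLc, hlip⟩ := abs_cZeroKer_sub_le hd hL1 0
  set ε : ℝ := ∑ i, |y i| - 1 / 2 with hε
  have hε0 : 0 < ε := by rw [hε]; linarith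
  -- `|G_L(y,0)| ≤ (Lc + C)/L^{j+1}` for all large `j`
  have hkey : ∀ j : ℕ, 1 ≤ j → (d : ℝ) ≤ L ^ (j + 1) * ε →
      |cZeroKer d L y 0| ≤ (Lc + C) * (L ^ (j + 1))⁻¹ := by
    intro j hj hjε
    set Λ : ℝ := L ^ (j + 1) with hΛ
    have hΛ0 : 0 < Λ := pow_pos hL0 _
    obtain ⟨happ, hsum⟩ := floor_approx hΛ0 y
    set x : Site d := fun i => ⌊Λ * y i⌋ with hx
    -- `Γ_{j+1}(x;0) = 0` by finite range
    have hrange : Λ / 2 ≤ ((∑ i, (x i).natAbs : ℕ) : ℝ) := by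
      have : Λ / 2 ≤ Λ * (∑ i, |y i|) - d := by
        rw [hε] at hjε; nlinarith
      exact this.trans hsum
    have hzero : Gam d L 0 (j + 1) x = 0 := Gam_eq_zero hd hL0.le le_rfl (j + 1) x hrange
    have h1 := h31 0 le_rfl zero_le_one j hj x
    rw [← hΛ, hzero, zero_sub, abs_neg, zero_mul, abs_mul, abs_of_pos (by positivity)] at h1
    -- `|G_L(x/Λ,0)| ≤ C/Λ`
    have h2 : |cZeroKer d L (fun i => ((x i : ℤ) : ℝ) / Λ) 0| ≤ C * Λ⁻¹ := by
      have hp : 0 < Λ ^ 2 / Λ ^ d := by positivity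
      have h3 : Λ ^ 2 / Λ ^ d * |cZeroKer d L (fun i => ((x i : ℤ) : ℝ) / Λ) 0| ≤
          Λ ^ 2 / Λ ^ d * (C * Λ⁻¹) := by
        refine h1.trans (le_of_eq ?_)
        field_simp
      exact le_of_mul_le_mul_left h3 hp
    -- Lipschitz step
    have h3 := hlip 0 le_rfl (fun i => ((x i : ℤ) : ℝ) / Λ) y
    simp only [zero_div, add_zero, one_pow, inv_one, mul_one] at h3
    have h4 : |cZeroKer d L y 0| ≤ |cZeroKer d L (fun i => ((x i : ℤ) : ℝ) / Λ) 0| + Lc * Λ⁻¹ := by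
      have := abs_sub_abs_le_abs_sub (cZeroKer d L y 0) (cZeroKer d L (fun i => ((x i : ℤ) : ℝ) / Λ) 0)
      rw [abs_sub_comm] at this
      have h5 : Lc * ‖(fun i => ((x i : ℤ) : ℝ) / Λ) - y‖ ≤ Lc * Λ⁻¹ :=
        mul_le_mul_of_nonneg_left happ hLc.le
      linarith
    calc |cZeroKer d L y 0| ≤ C * Λ⁻¹ + Lc * Λ⁻¹ := by linarith
      _ = (Lc + C) * Λ⁻¹ := by ring
  -- let `j → ∞`
  by_contra hne
  have hpos : 0 < |cZeroKer d L y 0| := abs_pos.2 hne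
  have hLinv : L⁻¹ < 1 := inv_lt_one_of_one_lt₀ (by linarith)
  have hLinv0 : 0 < L⁻¹ := by positivity
  obtain ⟨k₁, hk₁⟩ := exists_pow_lt_of_lt_one (div_pos hpos (by positivity : (0 : ℝ) < Lc + C)) hLinv
  obtain ⟨k₂, hk₂⟩ := exists_pow_lt_of_lt_one (div_pos hε0 (by positivity : (0 : ℝ) < d + 1)) hLinv
  set j : ℕ := max (max k₁ k₂) 1 with hj
  have hj1 : 1 ≤ j := le_max_right _ _
  have hjk₁ : k₁ ≤ j + 1 := le_trans (le_trans (le_max_left _ _) (le_max_left _ _)) (Nat.le_succ j)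
  have hjk₂ : k₂ ≤ j + 1 := le_trans (le_trans (le_max_right _ _) (le_max_left _ _)) (Nat.le_succ j)
  have hmono : ∀ {a b : ℕ}, a ≤ b → L⁻¹ ^ b ≤ L⁻¹ ^ a := fun hab =>
    pow_le_pow_of_le_one hLinv0.le hLinv.le hab
  have hLk : (L ^ (j + 1))⁻¹ = L⁻¹ ^ (j + 1) := by rw [inv_pow]
  have hd' : (0 : ℝ) < d := by exact_mod_cast hd
  have hjε : (d : ℝ) ≤ L ^ (j + 1) * ε := by
    have h1 : L⁻¹ ^ (j + 1) < ε / (d + 1) := lt_of_le_of_lt (hmono hjk₂) hk₂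
    have hLj0 : 0 < L ^ (j + 1) := pow_pos hL0 _
    rw [← hLk, lt_div_iff₀ (by positivity)] at h1
    have : (L ^ (j + 1))⁻¹ * (d + 1) * L ^ (j + 1) = d + 1 := by field_simp
    nlinarith [mul_lt_mul_of_pos_right h1 hLj0]
  have hb := hkey j hj1 hjε
  have h1 : L⁻¹ ^ (j + 1) < |cZeroKer d L y 0| / (Lc + C) := lt_of_le_of_lt (hmono hjk₁) hk₁
  rw [lt_div_iff₀ (by positivity)] at h1
  rw [hLk] at hb
  linarith [mul_comm (L⁻¹ ^ (j + 1)) (Lc + C)]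

/-- `G_L(y,0) = 0` as soon as `Σ_i|y_i| ≥ ½` (the boundary case by Lipschitz continuity).
[cite: Slade2017, §10.3 ("with compact support in ℝ^d")] -/
theorem cZeroKer_zero_eq_zero_of_half_le (hd : 1 ≤ d) {L : ℝ} (hL : 2 ≤ L) {y : Fin d → ℝ}
    (hy : 1 / 2 ≤ ∑ i, |y i|) : cZeroKer d L y 0 = 0 := by
  rcases hy.lt_or_eq with hlt | heq
  · exact cZeroKer_zero_eq_zero_of_half_lt hd hL hlt
  · obtain ⟨Lc, hLc, hlip⟩ := abs_cZeroKer_sub_le hd (by linarith : (1 : ℝ) ≤ L) 0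
    have hε : ∀ ε : ℝ, 0 < ε → |cZeroKer d L y 0| ≤ Lc * (ε * ‖y‖) := by
      intro ε hε
      have h1 : 1 / 2 < ∑ i, |((1 + ε) • y) i| := by
        have e : ∑ i, |((1 + ε) • y) i| = (1 + ε) * ∑ i, |y i| := by
          rw [Finset.mul_sum]
          refine Finset.sum_congr rfl fun i _ => ?_
          rw [Pi.smul_apply, smul_eq_mul, abs_mul, abs_of_pos (by linarith)]
        rw [e, ← heq]
        nlinarith
      have h2 := cZeroKer_zero_eq_zero_of_half_lt hd hL h1
      have h3 := hlip 0 le_rfl y ((1 + ε) • y)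
      simp only [zero_div, add_zero, one_pow, inv_one, mul_one] at h3
      rw [h2, sub_zero] at h3
      have e2 : y - (1 + ε) • y = (-ε) • y := by
        rw [sub_eq_add_neg, ← neg_smul, show y + -(1 + ε) • y = (1 : ℝ) • y + -(1 + ε) • y by
          rw [one_smul], ← add_smul]
        congr 1; ring
      rw [e2, norm_smul, Real.norm_eq_abs, abs_neg, abs_of_pos hε] at h3
      exact h3
    by_contra hne
    have hpos : 0 < |cZeroKer d L y 0| := abs_pos.2 hne
    have hy0 : 0 < ‖y‖ := by
      by_contra h0
      have : ‖y‖ = 0 := le_antisymm (le_of_not_gt h0) (norm_nonneg _)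
      rw [norm_eq_zero] at this
      subst this
      simp at heq
    have := hε (|cZeroKer d L y 0| / (2 * Lc * ‖y‖)) (by positivity)
    have e : Lc * (|cZeroKer d L y 0| / (2 * Lc * ‖y‖) * ‖y‖) = |cZeroKer d L y 0| / 2 := by
      field_simp
    rw [e] at this
    linarith

/-- `G_L(y,0) = 0` for `‖y‖_∞ > ½` (`Σ|y_i| ≥ ‖y‖_∞`). [cite: Slade2017, §10.3] -/
theorem cZeroKer_zero_eq_zero_of_norm_gt (hd : 1 ≤ d) {L : ℝ} (hL : 2 ≤ L) {y : Fin d → ℝ}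
    (hy : 1 / 2 < ‖y‖) : cZeroKer d L y 0 = 0 := by
  refine cZeroKer_zero_eq_zero_of_half_lt hd hL (lt_of_lt_of_le hy ?_)
  refine (pi_norm_le_iff_of_nonneg (Finset.sum_nonneg fun i _ => abs_nonneg (y i))).2 fun i => ?_
  rw [Real.norm_eq_abs]
  exact Finset.single_le_sum (f := fun j => |y j|) (fun j _ => abs_nonneg _) (Finset.mem_univ i)

/-! ### The continuum pairings `J_l = ∫G_L(y,0)G_L(y/L^l,0)dy` -/

/-- **`J_l = ∫_{ℝ^d} G_L(y,0) G_L(y/L^l,0) dy`** — the scaling limit of the lattice pair sums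
`Σ_xΓ_k(x;0)Γ_{k+l}(x;0)` (Slade's `⟨c₀,c_l⟩` for the decomposition of the standard Laplacian, no
mass integral). [cite: Slade2017, Lemma 5.2.2 (proof, §10.4: c_k(x) = L^{-(d-α)k}c₀(L^{-k}x), ⟨f,g⟩ = ∫fg)] -/
def innerG0 (d : ℕ) (L : ℝ) (l : ℕ) : ℝ :=
  ∫ y : Fin d → ℝ, cZeroKer d L y 0 * cZeroKer d L (fun i => y i / L ^ l) 0

/-- The integrand `F_l(y) = G_L(y,0)G_L(y/L^l,0)` is Lipschitz, vanishes for `‖y‖_∞ > ½`, and is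
bounded — uniformly in `l`. [cite: Slade2017, §10.4 (‖∇(c₀c_l)‖_∞, "c₀ has support of order 1")] -/
theorem pairKer_lipschitz_support (hd : 1 ≤ d) {L : ℝ} (hL : 2 ≤ L) :
    ∃ K : ℝ, 0 < K ∧ ∀ l : ℕ,
      (∀ y y' : Fin d → ℝ, |cZeroKer d L y 0 * cZeroKer d L (fun i => y i / L ^ l) 0 -
          cZeroKer d L y' 0 * cZeroKer d L (fun i => y' i / L ^ l) 0| ≤ K * ‖y - y'‖) ∧
      (∀ y : Fin d → ℝ, 1 / 2 < ‖y‖ → cZeroKer d L y 0 * cZeroKer d L (fun i => y i / L ^ l) 0 = 0) ∧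
      (∀ y : Fin d → ℝ, |cZeroKer d L y 0 * cZeroKer d L (fun i => y i / L ^ l) 0| ≤ K) := by
  have hL1 : (1 : ℝ) ≤ L := by linarith
  have hL0 : (0 : ℝ) < L := by linarith
  obtain ⟨C₀, hC₀, hb'⟩ := abs_cZeroKer_le hd hL1 0
  have hb : ∀ y : Fin d → ℝ, |cZeroKer d L y 0| ≤ C₀ := fun y => by
    have := (hb' 0 le_rfl y).2
    simpa using this
  obtain ⟨Lc, hLc, hlip'⟩ := abs_cZeroKer_sub_le hd hL1 0
  have hlip : ∀ y y' : Fin d → ℝ, |cZeroKer d L y 0 - cZeroKer d L y' 0| ≤ Lc * ‖y - y'‖ := fun y y' => by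
    have := hlip' 0 le_rfl y y'
    simpa using this
  refine ⟨2 * C₀ * Lc + C₀ * C₀, by positivity, fun l => ⟨fun y y' => ?_, fun y hy => ?_, fun y => ?_⟩⟩
  · have hΛ : (1 : ℝ) ≤ L ^ l := one_le_pow₀ hL1
    have e : cZeroKer d L y 0 * cZeroKer d L (fun i => y i / L ^ l) 0 -
        cZeroKer d L y' 0 * cZeroKer d L (fun i => y' i / L ^ l) 0 =
        (cZeroKer d L y 0 - cZeroKer d L y' 0) * cZeroKer d L (fun i => y i / L ^ l) 0 +
          cZeroKer d L y' 0 * (cZeroKer d L (fun i => y i / L ^ l) 0 -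
            cZeroKer d L (fun i => y' i / L ^ l) 0) := by
      ring
    rw [e]
    have h1 := hlip y y'
    have h2 := hlip (fun i => y i / L ^ l) (fun i => y' i / L ^ l)
    have hn : ‖(fun i => y i / L ^ l) - (fun i => y' i / L ^ l)‖ ≤ ‖y - y'‖ := by
      have e2 : (fun i => y i / L ^ l) - (fun i => y' i / L ^ l) = (L ^ l)⁻¹ • (y - y') := by
        funext i; simp only [Pi.sub_apply, Pi.smul_apply, smul_eq_mul]; ring
      rw [e2, norm_smul, Real.norm_eq_abs, abs_of_pos (by positivity)]
      exact mul_le_of_le_one_left (norm_nonneg _) (inv_le_one_of_one_le₀ hΛ)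
    calc |(cZeroKer d L y 0 - cZeroKer d L y' 0) * cZeroKer d L (fun i => y i / L ^ l) 0 +
          cZeroKer d L y' 0 * (cZeroKer d L (fun i => y i / L ^ l) 0 -
            cZeroKer d L (fun i => y' i / L ^ l) 0)|
        ≤ |cZeroKer d L y 0 - cZeroKer d L y' 0| * |cZeroKer d L (fun i => y i / L ^ l) 0| +
          |cZeroKer d L y' 0| * |cZeroKer d L (fun i => y i / L ^ l) 0 -
            cZeroKer d L (fun i => y' i / L ^ l) 0| := by
          refine (abs_add_le _ _).trans ?_
          rw [abs_mul, abs_mul]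
      _ ≤ Lc * ‖y - y'‖ * C₀ + C₀ * (Lc * ‖y - y'‖) := by
          gcongr
          · exact hb _
          · exact hb _
          · exact h2.trans (mul_le_mul_of_nonneg_left hn hLc.le)
      _ = 2 * C₀ * Lc * ‖y - y'‖ := by ring
      _ ≤ (2 * C₀ * Lc + C₀ * C₀) * ‖y - y'‖ := by
          have := norm_nonneg (y - y'); nlinarith
  · rw [cZeroKer_zero_eq_zero_of_norm_gt hd hL hy, zero_mul]
  · rw [abs_mul]
    calc |cZeroKer d L y 0| * |cZeroKer d L (fun i => y i / L ^ l) 0| ≤ C₀ * C₀ :=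
          mul_le_mul (hb _) (hb _) (abs_nonneg _) hC₀.le
      _ ≤ 2 * C₀ * Lc + C₀ * C₀ := by nlinarith

/-- **`|J_l| ≤ K`**, uniformly in `l`. [cite: Slade2017, §10.4 ("Since c₀ has support of order 1 …")] -/
theorem abs_innerG0_le (hd : 1 ≤ d) {L : ℝ} (hL : 2 ≤ L) :
    ∃ K : ℝ, 0 < K ∧ ∀ l : ℕ, |innerG0 d L l| ≤ K := by
  obtain ⟨K, hK, hF⟩ := pairKer_lipschitz_support hd hL
  refine ⟨K, hK, fun l => ?_⟩
  obtain ⟨-, hsuppF, hbF⟩ := hF l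
  unfold innerG0
  have hsupp : Function.support (fun y : Fin d → ℝ =>
      cZeroKer d L y 0 * cZeroKer d L (fun i => y i / L ^ l) 0) ⊆
      Metric.closedBall (0 : Fin d → ℝ) (1 / 2) := by
    intro y hy
    rw [Metric.mem_closedBall, dist_zero_right]
    by_contra h
    exact hy (hsuppF y (lt_of_not_ge h))
  rw [← setIntegral_eq_integral_of_forall_compl_eq_zero (s := Metric.closedBall (0 : Fin d → ℝ) (1 / 2))
    fun y hy => Function.notMem_support.1 fun h => hy (hsupp h)]
  have hfin : volume (Metric.closedBall (0 : Fin d → ℝ) (1 / 2)) < ⊤ := by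
    rw [Real.volume_pi_closedBall _ (by norm_num)]; exact ENNReal.ofReal_lt_top
  have h := norm_setIntegral_le_of_norm_le_const hfin (C := K) fun y _ => by
    rw [Real.norm_eq_abs]; exact hbF y
  rw [Real.norm_eq_abs] at h
  refine h.trans ?_
  rw [Measure.real, Real.volume_pi_closedBall _ (by norm_num), ENNReal.toReal_ofReal (by positivity)]
  norm_num

/-! ### The lattice pair sums `(Γ_k,Γ_{k+l})` at `s = 0` -/

/-- **The asymptotics of the lattice pair sums at `s = 0`**: for `d ≥ 1`, `L ≥ 2` there is `C` such
that for all `k ≥ 2`, `l ≥ 0`, with `P_{k,l} = ((L^k)²/(L^k)^d)((L^{k+l})²/(L^{k+l})^d)(L^k)^d`,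
`|Σ_{|x|₁<½L^k}Γ_k(x;0)Γ_{k+l}(x;0) - P_{k,l}J_l| ≤ CP_{k,l}(L^k)⁻¹` — "(10.45)
`(C_k,C_{k+l}) = L^{εk}⟨c₀,c_l⟩ + O(L^{εk}L^{-k}L^{-(d-α)l})`" for the decomposition of the standard
Laplacian (`R_{k,x} = Γ_{k;0,x} - (Λ²/Λ^d)G_L(x/Λ,0)`, Riemann sums, and the supports `O(L^{dk})`).
[cite: Slade2017, Lemma 5.2.2 (proof, §10.4, displays (10.44)–(10.46))] -/
theorem sum_Gam_mul_Gam_asymp (hd : 1 ≤ d) {L : ℝ} (hL : 2 ≤ L) :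
    ∃ C : ℝ, 0 < C ∧ ∀ k : ℕ, 2 ≤ k → ∀ l : ℕ,
      |∑ x ∈ PT.ball (L ^ k / 2), Gam d L 0 k x * Gam d L 0 (k + l) x -
        ((L ^ k) ^ 2 / (L ^ k) ^ d) * ((L ^ (k + l)) ^ 2 / (L ^ (k + l)) ^ d) * (L ^ k) ^ d *
          innerG0 d L l| ≤
        C * (((L ^ k) ^ 2 / (L ^ k) ^ d) * ((L ^ (k + l)) ^ 2 / (L ^ (k + l)) ^ d) * (L ^ k) ^ d) *
          (L ^ k)⁻¹ := by
  have hd' : (1 : ℝ) ≤ d := by exact_mod_cast hd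
  have hL1 : (1 : ℝ) ≤ L := by linarith
  have hL0 : (0 : ℝ) < L := by linarith
  obtain ⟨C₁, hC₁, h31⟩ := abs_Gam_sub_scaling_le hd hL
  obtain ⟨C₀, hC₀, hb'⟩ := abs_cZeroKer_le hd hL1 0
  have hb : ∀ y : Fin d → ℝ, |cZeroKer d L y 0| ≤ C₀ := fun y => by
    have := (hb' 0 le_rfl y).2
    simpa using this
  obtain ⟨K, hK, hF⟩ := pairKer_lipschitz_support hd hL
  refine ⟨K * 4 ^ d + 2 ^ d * (2 * C₀ * C₁ + C₁ * C₁) + 1, by positivity, fun k hk l => ?_⟩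
  obtain ⟨hlipF, hsuppF, hbF⟩ := hF l
  -- `k = (k-1) + 1` with `k - 1 ≥ 1`
  obtain ⟨j, rfl⟩ : ∃ j, k = j + 1 := ⟨k - 1, by omega⟩
  have hj : 1 ≤ j := by omega
  set Λ : ℝ := L ^ (j + 1) with hΛ
  set Λ' : ℝ := L ^ (j + 1 + l) with hΛ'
  have hΛ0 : 0 < Λ := pow_pos hL0 _
  have hΛ1 : 1 ≤ Λ := one_le_pow₀ hL1
  have hΛ'eq : Λ' = Λ * L ^ l := by rw [hΛ', hΛ, pow_add]
  have hLl : (1 : ℝ) ≤ L ^ l := one_le_pow₀ hL1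
  have hΛ'0 : 0 < Λ' := pow_pos hL0 _
  have hΛΛ' : Λ ≤ Λ' := by rw [hΛ'eq]; exact le_mul_of_one_le_right hΛ0.le hLl
  -- the scaling factors
  set q : ℝ := Λ ^ 2 / Λ ^ d with hq
  set q' : ℝ := Λ' ^ 2 / Λ' ^ d with hq'
  have hq0 : 0 < q := by rw [hq]; positivity
  have hq'0 : 0 < q' := by rw [hq']; positivity
  -- the errors `E(x) = Γ_k(x)/q - G_L(x/Λ,0)`
  set c : Site d → ℝ := fun x => cZeroKer d L (fun i => (x i : ℝ) / Λ) 0 with hc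
  set c' : Site d → ℝ := fun x => cZeroKer d L (fun i => (x i : ℝ) / Λ') 0 with hc'
  set E : Site d → ℝ := fun x => Gam d L 0 (j + 1) x / q - c x with hE
  set E' : Site d → ℝ := fun x => Gam d L 0 (j + 1 + l) x / q' - c' x with hE'
  have hCk : ∀ x, Gam d L 0 (j + 1) x = q * (c x + E x) := by
    intro x; simp only [hE]; field_simp; ring
  have hCm : ∀ x, Gam d L 0 (j + 1 + l) x = q' * (c' x + E' x) := by
    intro x; simp only [hE']; field_simp; ring
  have hEb : ∀ x, |E x| ≤ C₁ * Λ⁻¹ := by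
    intro x
    have h := h31 0 le_rfl zero_le_one j hj x
    rw [← hΛ, zero_mul] at h
    have e : E x = q⁻¹ * (Gam d L 0 (j + 1) x - q * c x) := by
      simp only [hE, hc]; field_simp
    rw [e, abs_mul, abs_of_pos (inv_pos.2 hq0)]
    calc q⁻¹ * |Gam d L 0 (j + 1) x - q * c x| ≤ q⁻¹ * (C₁ * (Λ / Λ ^ d)) :=
          mul_le_mul_of_nonneg_left h (inv_pos.2 hq0).le
      _ = C₁ * Λ⁻¹ := by rw [hq]; field_simp
  have hE'b : ∀ x, |E' x| ≤ C₁ * Λ⁻¹ := by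
    intro x
    have h := h31 0 le_rfl zero_le_one (j + l) (by omega) x
    have eidx : j + l + 1 = j + 1 + l := by omega
    rw [eidx, ← hΛ', zero_mul] at h
    have e : E' x = q'⁻¹ * (Gam d L 0 (j + 1 + l) x - q' * c' x) := by
      simp only [hE', hc']; field_simp
    rw [e, abs_mul, abs_of_pos (inv_pos.2 hq'0)]
    calc q'⁻¹ * |Gam d L 0 (j + 1 + l) x - q' * c' x| ≤ q'⁻¹ * (C₁ * (Λ' / Λ' ^ d)) :=
          mul_le_mul_of_nonneg_left h (inv_pos.2 hq'0).le
      _ = C₁ * Λ'⁻¹ := by rw [hq']; field_simp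
      _ ≤ C₁ * Λ⁻¹ := mul_le_mul_of_nonneg_left (inv_anti₀ hΛ0 hΛΛ') hC₁.le
  have hcb : ∀ x, |c x| ≤ C₀ := fun x => hb _
  have hc'b : ∀ x, |c' x| ≤ C₀ := fun x => hb _
  -- the ball and its cardinality
  set B : Finset (Site d) := PT.ball (Λ / 2) with hB
  have hcard : ((B.card : ℕ) : ℝ) ≤ (2 * Λ) ^ d := by
    refine (PT.card_ball_le (by positivity)).trans ?_
    apply pow_le_pow_left₀ (by positivity)
    linarith
  -- main term: the Riemann sum of `F_l`
  set F : (Fin d → ℝ) → ℝ := fun y => cZeroKer d L y 0 * cZeroKer d L (fun i => y i / L ^ l) 0 with hFdef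
  have hcc' : ∀ x, c x * c' x = F (fun i => (x i : ℝ) / Λ) := by
    intro x
    simp only [hc, hc', hFdef, hΛ'eq]
    congr 2
    funext i
    field_simp
  obtain ⟨-, hR⟩ := abs_riemannSum_sub_integral_le hK.le (by norm_num : (0 : ℝ) ≤ 1 / 2) hlipF hsuppF hΛ1
  have hsumF : ∑ x ∈ PT.box (Λ * (1 / 2) + 1), F (fun i => (x i : ℝ) / Λ) = ∑ x ∈ B, c x * c' x := by
    simp_rw [hcc']
    symm
    refine Finset.sum_subset (fun x hx => ?_) (fun x _ hx => ?_)
    · have hx' := PT.mem_ball.1 hx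
      exact PT.mem_box_of_lt (by linarith)
    · rw [hB, PT.mem_ball, not_lt] at hx
      simp only [hFdef]
      rw [cZeroKer_zero_eq_zero_of_half_le hd hL ?_, zero_mul]
      have e : ∑ i, |((x i : ℤ) : ℝ) / Λ| = ((∑ i, (x i).natAbs : ℕ) : ℝ) / Λ := by
        push_cast
        rw [Finset.sum_div]
        refine Finset.sum_congr rfl fun i _ => ?_
        rw [abs_div, abs_of_pos hΛ0, ← Int.cast_natCast, Int.natCast_natAbs, Int.cast_abs]
      rw [e, le_div_iff₀ hΛ0]
      linarith
  rw [hsumF] at hR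
  have hR' : |∑ x ∈ B, c x * c' x - Λ ^ d * innerG0 d L l| ≤ K * 4 ^ d * Λ⁻¹ * Λ ^ d := by
    have hΛd : 0 < Λ ^ d := pow_pos hΛ0 d
    have e : ∑ x ∈ B, c x * c' x - Λ ^ d * innerG0 d L l =
        Λ ^ d * ((Λ ^ d)⁻¹ * ∑ x ∈ B, c x * c' x - innerG0 d L l) := by
      unfold innerG0; field_simp
    rw [e, abs_mul, abs_of_pos hΛd, mul_comm]
    refine mul_le_mul_of_nonneg_right (hR.trans (le_of_eq ?_)) hΛd.le
    norm_num
  -- the three cross terms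
  have hX1 : |∑ x ∈ B, c x * E' x| ≤ (2 * Λ) ^ d * (C₀ * (C₁ * Λ⁻¹)) := by
    calc |∑ x ∈ B, c x * E' x| ≤ ∑ x ∈ B, |c x * E' x| := Finset.abs_sum_le_sum_abs _ _
      _ ≤ ∑ _x ∈ B, C₀ * (C₁ * Λ⁻¹) := Finset.sum_le_sum fun x _ => by
          rw [abs_mul]; exact mul_le_mul (hcb x) (hE'b x) (abs_nonneg _) hC₀.le
      _ = B.card * (C₀ * (C₁ * Λ⁻¹)) := by rw [Finset.sum_const, nsmul_eq_mul]
      _ ≤ (2 * Λ) ^ d * (C₀ * (C₁ * Λ⁻¹)) := mul_le_mul_of_nonneg_right hcard (by positivity)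
  have hX2 : |∑ x ∈ B, E x * c' x| ≤ (2 * Λ) ^ d * (C₁ * Λ⁻¹ * C₀) := by
    calc |∑ x ∈ B, E x * c' x| ≤ ∑ x ∈ B, |E x * c' x| := Finset.abs_sum_le_sum_abs _ _
      _ ≤ ∑ _x ∈ B, C₁ * Λ⁻¹ * C₀ := Finset.sum_le_sum fun x _ => by
          rw [abs_mul]; exact mul_le_mul (hEb x) (hc'b x) (abs_nonneg _) (by positivity)
      _ = B.card * (C₁ * Λ⁻¹ * C₀) := by rw [Finset.sum_const, nsmul_eq_mul]
      _ ≤ (2 * Λ) ^ d * (C₁ * Λ⁻¹ * C₀) := mul_le_mul_of_nonneg_right hcard (by positivity)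
  have hX3 : |∑ x ∈ B, E x * E' x| ≤ (2 * Λ) ^ d * (C₁ * Λ⁻¹ * (C₁ * Λ⁻¹)) := by
    calc |∑ x ∈ B, E x * E' x| ≤ ∑ x ∈ B, |E x * E' x| := Finset.abs_sum_le_sum_abs _ _
      _ ≤ ∑ _x ∈ B, C₁ * Λ⁻¹ * (C₁ * Λ⁻¹) := Finset.sum_le_sum fun x _ => by
          rw [abs_mul]; exact mul_le_mul (hEb x) (hE'b x) (abs_nonneg _) (by positivity)
      _ = B.card * (C₁ * Λ⁻¹ * (C₁ * Λ⁻¹)) := by rw [Finset.sum_const, nsmul_eq_mul]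
      _ ≤ (2 * Λ) ^ d * (C₁ * Λ⁻¹ * (C₁ * Λ⁻¹)) := mul_le_mul_of_nonneg_right hcard (by positivity)
  -- expand the sum
  have hexp : ∑ x ∈ B, Gam d L 0 (j + 1) x * Gam d L 0 (j + 1 + l) x =
      q * q' * ((∑ x ∈ B, c x * c' x) + (∑ x ∈ B, c x * E' x) + (∑ x ∈ B, E x * c' x) +
        ∑ x ∈ B, E x * E' x) := by
    rw [← Finset.sum_add_distrib, ← Finset.sum_add_distrib, ← Finset.sum_add_distrib, Finset.mul_sum]
    refine Finset.sum_congr rfl fun x _ => ?_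
    rw [hCk x, hCm x]
    ring
  rw [hexp]
  have hmain : q * q' * ((∑ x ∈ B, c x * c' x) + (∑ x ∈ B, c x * E' x) + (∑ x ∈ B, E x * c' x) +
      ∑ x ∈ B, E x * E' x) - q * q' * Λ ^ d * innerG0 d L l =
      q * q' * ((∑ x ∈ B, c x * c' x - Λ ^ d * innerG0 d L l) + (∑ x ∈ B, c x * E' x) +
        (∑ x ∈ B, E x * c' x) + ∑ x ∈ B, E x * E' x) := by ring
  rw [hmain, abs_mul, abs_of_pos (mul_pos hq0 hq'0)]
  have hΛinv : Λ⁻¹ ≤ 1 := inv_le_one_of_one_le₀ hΛ1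
  have herr : |(∑ x ∈ B, c x * c' x - Λ ^ d * innerG0 d L l) + (∑ x ∈ B, c x * E' x) +
      (∑ x ∈ B, E x * c' x) + ∑ x ∈ B, E x * E' x| ≤
      (K * 4 ^ d + 2 ^ d * (2 * C₀ * C₁ + C₁ * C₁) + 1) * (Λ ^ d * Λ⁻¹) := by
    have h2d : (2 * Λ) ^ d = 2 ^ d * Λ ^ d := mul_pow _ _ _
    calc |(∑ x ∈ B, c x * c' x - Λ ^ d * innerG0 d L l) + (∑ x ∈ B, c x * E' x) +
          (∑ x ∈ B, E x * c' x) + ∑ x ∈ B, E x * E' x|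
        ≤ |∑ x ∈ B, c x * c' x - Λ ^ d * innerG0 d L l| + |∑ x ∈ B, c x * E' x| +
            |∑ x ∈ B, E x * c' x| + |∑ x ∈ B, E x * E' x| := by
          refine (abs_add_le _ _).trans (add_le_add ((abs_add_le _ _).trans
            (add_le_add (abs_add_le _ _) le_rfl)) le_rfl)
      _ ≤ K * 4 ^ d * Λ⁻¹ * Λ ^ d + (2 * Λ) ^ d * (C₀ * (C₁ * Λ⁻¹)) + (2 * Λ) ^ d * (C₁ * Λ⁻¹ * C₀) +
            (2 * Λ) ^ d * (C₁ * Λ⁻¹ * (C₁ * Λ⁻¹)) := add_le_add (add_le_add (add_le_add hR' hX1) hX2) hX3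
      _ = (K * 4 ^ d + 2 ^ d * (2 * C₀ * C₁ + C₁ * C₁ * Λ⁻¹)) * (Λ ^ d * Λ⁻¹) := by rw [h2d]; ring
      _ ≤ (K * 4 ^ d + 2 ^ d * (2 * C₀ * C₁ + C₁ * C₁) + 1) * (Λ ^ d * Λ⁻¹) := by
          apply mul_le_mul_of_nonneg_right _ (by positivity)
          have : C₁ * C₁ * Λ⁻¹ ≤ C₁ * C₁ := mul_le_of_le_one_right (by positivity) hΛinv
          nlinarith [pow_pos (by norm_num : (0 : ℝ) < 2) d]
  calc q * q' * |(∑ x ∈ B, c x * c' x - Λ ^ d * innerG0 d L l) +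
        (∑ x ∈ B, c x * E' x) + (∑ x ∈ B, E x * c' x) + ∑ x ∈ B, E x * E' x|
      ≤ q * q' * ((K * 4 ^ d + 2 ^ d * (2 * C₀ * C₁ + C₁ * C₁) + 1) * (Λ ^ d * Λ⁻¹)) :=
        mul_le_mul_of_nonneg_left herr (mul_pos hq0 hq'0).le
    _ = (K * 4 ^ d + 2 ^ d * (2 * C₀ * C₁ + C₁ * C₁) + 1) * (q * q' * Λ ^ d) * Λ⁻¹ := by ring

/-! ### Positivity: `(Γ_k,Γ_m) ≥ 0`, hence `J_l ≥ 0`, and `J_0 > 0` -/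

/-- **`Σ_{|x|₁<R}Γ_k(x;s)Γ_m(x;s) ≥ 0` for every `s ≥ 0`** and `R` beyond both ranges (Parseval: the
Fourier sides `Γ̂_k, Γ̂_m ≥ 0`; at `s = 0` as the limit `s ↓ 0`). [cite: Slade2017, Lemma 5.2.2 (proof, §10.4: "each inner product … is nonnegative")] -/
theorem sum_Gam_mul_Gam_nonneg (hd : 1 ≤ d) {L : ℝ} (hL : 1 < L) {s : ℝ} (hs : 0 ≤ s) (k m : ℕ)
    {R : ℝ} (hRk : L ^ k / 2 < R) (hRm : L ^ m / 2 < R) :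
    0 ≤ ∑ x ∈ PT.ball R, Gam d L s k x * Gam d L s m x := by
  have hL0 : (0 : ℝ) ≤ L := by linarith
  -- the case `s > 0` by Parseval
  have hpos : ∀ s : ℝ, 0 < s → 0 ≤ ∑ x ∈ PT.ball R, Gam d L s k x * Gam d L s m x := by
    intro s hs'
    rw [sum_mul_eq_setIntegral_cosSeries (PT.ball R) (fun x hx => neg_mem_ball x hx)
      (Gam d L s k) (Gam d L s m) (fun x => Gam_neg L s m x)]
    refine mul_nonneg (by positivity) (setIntegral_nonneg (measurableSet_brillouin d) fun p _ => ?_)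
    rw [CTWSAW.cosSeries_Gam hd hL0 hs' k hRk p, CTWSAW.cosSeries_Gam hd hL0 hs' m hRm p]
    exact mul_nonneg (CTWSAW.GamHat_nonneg hL0 hs'.le k p) (CTWSAW.GamHat_nonneg hL0 hs'.le m p)
  rcases hs.lt_or_eq with hs' | hs'
  · exact hpos s hs'
  · rw [← hs']
    have hT : Tendsto (fun s => ∑ x ∈ PT.ball R, Gam d L s k x * Gam d L s m x) (𝓝[>] 0)
        (𝓝 (∑ x ∈ PT.ball R, Gam d L 0 k x * Gam d L 0 m x)) :=
      tendsto_finsetSum _ fun x _ =>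
        (tendsto_Gam_mass hd hL0 k x).mul (tendsto_Gam_mass hd hL0 m x)
    exact ge_of_tendsto hT (eventually_mem_nhdsWithin.mono fun s hs'' => hpos s hs'')

/-- **`J_l ≥ 0` for every `l`**: the rescaled nonnegative lattice pair sums converge to `J_l`.
[cite: Slade2017, Lemma 5.2.2 (proof, §10.4: "each inner product … is nonnegative")] -/
theorem innerG0_nonneg (hd : 1 ≤ d) {L : ℝ} (hL : 2 ≤ L) (l : ℕ) : 0 ≤ innerG0 d L l := by
  have hL1 : (1 : ℝ) < L := by linarith
  have hL0 : (0 : ℝ) < L := by linarith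
  obtain ⟨C, hC, hA⟩ := sum_Gam_mul_Gam_asymp hd hL
  -- `J_l ≥ -C (L^k)⁻¹` for every `k ≥ 2`
  have hk : ∀ k : ℕ, 2 ≤ k → -(C * (L ^ k)⁻¹) ≤ innerG0 d L l := by
    intro k hk
    have hΛ0 : (0 : ℝ) < L ^ k := pow_pos hL0 k
    have h := hA k hk l
    set P : ℝ := ((L ^ k) ^ 2 / (L ^ k) ^ d) * ((L ^ (k + l)) ^ 2 / (L ^ (k + l)) ^ d) * (L ^ k) ^ d
      with hP
    have hP0 : 0 < P := by rw [hP]; positivity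
    -- the lattice sum is nonnegative (extend the ball beyond both ranges)
    have hsum : 0 ≤ ∑ x ∈ PT.ball (L ^ k / 2), Gam d L 0 k x * Gam d L 0 (k + l) x := by
      have hR1 : L ^ k / 2 < L ^ (k + l) / 2 + 1 := by
        have : L ^ k ≤ L ^ (k + l) := pow_le_pow_right₀ hL1.le (by omega)
        linarith
      have hR2 : L ^ (k + l) / 2 < L ^ (k + l) / 2 + 1 := by linarith
      have e : ∑ x ∈ PT.ball (L ^ k / 2), Gam d L 0 k x * Gam d L 0 (k + l) x =
          ∑ x ∈ PT.ball (L ^ (k + l) / 2 + 1), Gam d L 0 k x * Gam d L 0 (k + l) x := by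
        refine Finset.sum_subset (fun x hx => PT.mem_ball.2 (lt_trans (PT.mem_ball.1 hx) hR1))
          fun x _ hx => ?_
        rw [PT.mem_ball, not_lt] at hx
        rw [Gam_eq_zero hd hL0.le le_rfl k x hx, zero_mul]
      rw [e]
      exact sum_Gam_mul_Gam_nonneg hd hL1 le_rfl k (k + l) hR1 hR2
    have h2 := (abs_le.1 h).2
    have h3 : 0 ≤ P * (innerG0 d L l + C * (L ^ k)⁻¹) := by
      have e : P * (innerG0 d L l + C * (L ^ k)⁻¹) = P * innerG0 d L l + C * P * (L ^ k)⁻¹ := by ring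
      rw [e]
      linarith
    have h4 := (mul_nonneg_iff_of_pos_left hP0).1 h3
    linarith
  by_contra hneg
  push Not at hneg
  have hLinv : L⁻¹ < 1 := inv_lt_one_of_one_lt₀ hL1
  obtain ⟨n, hn⟩ := exists_pow_lt_of_lt_one (div_pos (neg_pos.2 hneg) hC) hLinv
  have h := hk (n + 2) (by omega)
  have hmono : L⁻¹ ^ (n + 2) ≤ L⁻¹ ^ n := pow_le_pow_of_le_one (by positivity) hLinv.le (by omega)
  rw [← inv_pow] at h
  have : C * L⁻¹ ^ (n + 2) < -innerG0 d L l := by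
    calc C * L⁻¹ ^ (n + 2) ≤ C * L⁻¹ ^ n := mul_le_mul_of_nonneg_left hmono hC.le
      _ < C * (-innerG0 d L l / C) := mul_lt_mul_of_pos_left hn hC
      _ = -innerG0 d L l := by field_simp
  linarith

/-- **`J_0 = ∫G_L(y,0)²dy > 0`** ("with the first term strictly positive"): `G_L(·,0)` is continuous
(Lipschitz) and `G_L(0,0) > 0` (`FRD.exists_cZeroKer_zero_ge`).
[cite: Slade2017, Lemma 5.2.2 (proof, §10.4: "with the first term strictly positive")] -/
theorem innerG0_zero_pos (hd : 1 ≤ d) {L : ℝ} (hL : 2 ≤ L) : 0 < innerG0 d L 0 := by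
  have hL1 : (1 : ℝ) ≤ L := by linarith
  obtain ⟨σ₂, cG, hσ₂, hcG, hge⟩ := exists_cZeroKer_zero_ge hd hL
  obtain ⟨Lc, hLc, hlip'⟩ := abs_cZeroKer_sub_le hd hL1 0
  obtain ⟨K, hK, hF⟩ := pairKer_lipschitz_support hd hL
  obtain ⟨hlipF, hsuppF, -⟩ := hF 0
  have hlip : ∀ y y' : Fin d → ℝ, |cZeroKer d L y 0 - cZeroKer d L y' 0| ≤ Lc * ‖y - y'‖ := fun y y' => by
    have := hlip' 0 le_rfl y y'
    simpa using this
  -- the integrand is `G(y)²`, continuous, nonnegative, integrable, positive at `0`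
  have e : (fun y : Fin d → ℝ => cZeroKer d L y 0 * cZeroKer d L (fun i => y i / L ^ 0) 0) =
      fun y => cZeroKer d L y 0 ^ 2 := by
    funext y
    simp only [pow_zero, div_one, sq]
  have hcontG : Continuous fun y : Fin d → ℝ => cZeroKer d L y 0 := by
    have hl : LipschitzWith (Real.toNNReal Lc) (fun y : Fin d → ℝ => cZeroKer d L y 0) :=
      LipschitzWith.of_dist_le_mul fun y y' => by
        rw [Real.dist_eq, dist_eq_norm, Real.coe_toNNReal Lc hLc.le]
        exact hlip y y'
    exact hl.continuous
  obtain ⟨hint, -⟩ := abs_riemannSum_sub_integral_le hK.le (by norm_num : (0 : ℝ) ≤ 1 / 2) hlipF hsuppF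
    (le_refl (1 : ℝ))
  unfold innerG0
  rw [e] at hint ⊢
  have h0 : 0 < cZeroKer d L 0 0 ^ 2 := by
    have h1 : 0 < cZeroKer d L 0 0 := lt_of_lt_of_le hcG (hge 0 le_rfl hσ₂.le)
    positivity
  exact (integral_pos_iff_support_of_nonneg (fun y => sq_nonneg _) hint).2
    ((hcontG.pow 2).isOpen_support.measure_pos volume ⟨0, Function.mem_support.2 h0.ne'⟩)

end FRD

end LongRangePhi4

end Literature.Barriers.CriticalPhenomena
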